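import Summits.NavierStokesRegularity.NavierStokesRegularity.Theorems.SoloSalvageWu2026WeakProduct
import Literature.Claims.NS.Wu2026
import HarnessLib

/-!
# C177 `Wu2026` — Prop 3.3 (part 6): the weak gradient of the Euler tangent on `{|y| > 1}`

D-0090 NS-CLAIMS sweep, claim C177 (W. Wu, arXiv:2608.22471v1), skeleton
`Literature/Claims/NS/Wu2026.lean` (typist-10 g6; rev 2); kernel objects for the binder `hP33`
of `claim_of_steps''` — Proposition 3.3 p.20 («the Euler tangent satisfies div(β(Q)V) = 0 in
D′({|y| > 1})»). The input (3.35)/(3.53) «V ∈ W^{1,9/5}(U) ∩ L^{9/2}(U), U := {|y| > 1}» is the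
field `Tangent.sobolev` of the skeleton: columns `G y k = ∂_k V` tested against `C_c^∞(U)` with
`|G|^{9/5}`, `|V|^{9/2}` locally integrable — but with no measurability clause on `G`. This file
packages it in the vocabulary of `Literature.Analysis.FunctionSpaces.HasWeakFDerivOn`:

* `Tangent.exists_hasWeakFDerivOn` — there is `gV : E3 → E3 →L[ℝ] E3`, a weak Fréchet
  derivative of `T.V` on the open set `{|y| > 1}`, with `gV ∈ L^{9/5}(K)` and `V ∈ L^{9/2}(K)`
  for every compact `K ⊆ {|y| > 1}` (columns replaced by locally integrable ones via part 2's
  `exists_locallyIntegrableOn_weakPartial`, then `gV w = Σ_k w_k ∂_k V`).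

Seat ns-in-wu-p33 (cell pub/ns-inputs, D-0154 (2) INPUTS). WHAT THIS IS NOT: not a claim about
NS regularity or blow-up; no summit statement is proved here; records, not a verdict on the
preprint.
-/

noncomputable section

set_option linter.dupNamespace false

open MeasureTheory TopologicalSpace Set Function Filter Topology Metric
open scoped ENNReal NNReal Topology ContDiff RealInnerProductSpace

namespace Summit.NavierStokesRegularity.NavierStokesRegularity.Theorems.Wu2026Salvage

open Literature.Analysis.FluidPDE Literature.Analysis.FunctionSpaces Literature.Claims.NS.Wu2026

/-! ### The exterior region as an open set -/

/-- `{|y| > 1}` is open. [cite: Wu2026, (3.60) p.20 (the open set {|y| > 1})] -/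
theorem isOpen_exterior : IsOpen (exterior : Set E3) :=
  isOpen_lt continuous_const continuous_norm

/-- `{|y| > 1} ⊆ ℝ³ ∖ {0}`. [cite: Wu2026, p.18 l.7–8] -/
theorem exterior_subset_punctured : (exterior : Set E3) ⊆ punctured := by
  intro y hy h0
  have hy' : 1 < ‖y‖ := hy
  rw [show y = 0 from h0, norm_zero] at hy'
  exact absurd hy' (by norm_num)

/-! ### `L^p` bookkeeping from `rpow`-integrability -/

/-- `(9/2 : ℝ≥0∞).toReal = 9/2`, `(9/5 : ℝ≥0∞).toReal = 9/5` etc. [folklore] -/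
theorem ennreal_toReal_div_ofNat (a b : ℕ) [a.AtLeastTwo] [b.AtLeastTwo] :
    ((OfNat.ofNat a : ℝ≥0∞) / OfNat.ofNat b).toReal = (OfNat.ofNat a : ℝ) / OfNat.ofNat b := by
  rw [ENNReal.toReal_div, ENNReal.toReal_ofNat, ENNReal.toReal_ofNat]

/-- From `∫_K ‖f‖^r < ∞` (as `IntegrableOn`) and measurability to `f ∈ L^r(K)`. [folklore] -/
theorem memLp_of_integrableOn_norm_rpow {F : Type*} [NormedAddCommGroup F] {f : E3 → F}
    {K : Set E3} {r : ℝ≥0∞} (hr0 : r ≠ 0) (hrT : r ≠ ⊤)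
    (hf : AEStronglyMeasurable f (volume.restrict K))
    (hint : IntegrableOn (fun y => ‖f y‖ ^ r.toReal) K volume) : MemLp f r (volume.restrict K) :=
  (integrable_norm_rpow_iff hf hr0 hrT).1 hint

section Package

variable {ν : ℝ} {v : E3 → E3} {p : E3 → ℝ}

/-- `V ∈ L^{9/2}(K)` for compact `K ⊆ {|y| > 1}` ((3.35), second half). [cite: Wu2026, (3.35) p.13] -/
theorem Tangent.memLp_V_nineHalves (T : Tangent ν v p) {K : Set E3} (hK : IsCompact K)
    (hKU : K ⊆ exterior) : MemLp T.V ((9 : ℝ≥0∞) / 2) (volume.restrict K) := by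
  obtain ⟨G, hint, -⟩ := T.sobolev
  obtain ⟨hVm, -, -⟩ := T.locInt
  refine memLp_of_integrableOn_norm_rpow (by norm_num) (ENNReal.div_ne_top (by norm_num) (by norm_num))
    hVm.restrict ?_
  rw [ennreal_toReal_div_ofNat]
  exact (hint K hK hKU).2

/-- **The weak gradient of the tangent velocity on `{|y| > 1}`.** There is
`gV : E3 → E3 →L[ℝ] E3` with: `gV` is a weak Fréchet derivative of `T.V` on the open set
`{|y| > 1}` (in the sense of `HasWeakFDerivOn`), and `gV ∈ L^{9/5}(K)` for every compact
`K ⊆ {|y| > 1}` — the field `Tangent.sobolev` ((3.35): «V ∈ W^{1,9/5}_loc ∩ L^{9/2}_loc on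
{|y| > 1}») with its columns replaced by locally integrable modifications
(`exists_locallyIntegrableOn_weakPartial`) and assembled as `gV y w = Σ_k w_k ∂_k V(y)`.
[cite: Wu2026, (3.35) p.13 l.70–83, (3.53) p.20] -/
theorem Tangent.exists_hasWeakFDerivOn (T : Tangent ν v p) :
    ∃ gV : E3 → E3 →L[ℝ] E3,
      HasWeakFDerivOn (⟨exterior, isOpen_exterior⟩ : Opens E3) volume T.V gV ∧
      ∀ K : Set E3, IsCompact K → K ⊆ exterior →
        MemLp gV ((9 : ℝ≥0∞) / 5) (volume.restrict K) := by
  obtain ⟨G, hint, hid⟩ := T.sobolev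
  obtain ⟨hVm, -, -⟩ := T.locInt
  -- `V` is locally integrable on the exterior region
  have hVloc : LocallyIntegrableOn T.V (exterior : Set E3) volume := by
    refine (locallyIntegrableOn_iff isOpen_exterior.isLocallyClosed).2 fun K hKU hK => ?_
    haveI : IsFiniteMeasure (volume.restrict K) :=
      ⟨by rw [Measure.restrict_apply_univ]; exact hK.measure_lt_top⟩
    exact (Tangent.memLp_V_nineHalves T hK hKU).integrable
      (by rw [ENNReal.le_div_iff_mul_le (by norm_num) (by norm_num)]; norm_num)
  -- locally integrable columns
  have hcol : ∀ k : Fin 3, ∃ g' : E3 → E3, LocallyIntegrableOn g' (exterior : Set E3) volume ∧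
      (∀ y, ‖g' y‖ ≤ ‖G y k‖) ∧
      ∀ φ : E3 → ℝ, ContDiff ℝ ∞ φ → HasCompactSupport φ → tsupport φ ⊆ (exterior : Set E3) →
        ∫ y, (fderiv ℝ φ y (EuclideanSpace.single k 1)) • T.V y = -∫ y, φ y • g' y := fun k =>
    exists_locallyIntegrableOn_weakPartial isOpen_exterior hVloc fun φ hφ hφc hφU =>
      hid φ ⟨hφ, hφc, hφU⟩ k
  choose G' hG'loc hG'le hG'id using hcol
  -- the Fréchet derivative `gV y w = Σ_k w_k G'_k(y)`
  obtain ⟨L, hLapply⟩ : ∃ L : Fin 3 → E3 →L[ℝ] E3 →L[ℝ] E3, ∀ k (u w : E3), L k u w = w k • u :=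
    ⟨fun k => ContinuousLinearMap.smulRightL ℝ E3 E3 (EuclideanSpace.proj k), fun k u w => rfl⟩
  have hLnorm : ∀ k (u : E3), ‖L k u‖ ≤ ‖u‖ := fun k u =>
    ContinuousLinearMap.opNorm_le_bound _ (norm_nonneg _) fun w => by
      rw [hLapply, norm_smul, mul_comm]
      exact mul_le_mul_of_nonneg_left (by simpa using PiLp.norm_apply_le w k) (norm_nonneg _)
  obtain ⟨gV, hgV⟩ : ∃ gV : E3 → E3 →L[ℝ] E3, gV = ∑ k, fun y => L k (G' k y) := ⟨_, rfl⟩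
  have hgVapply : ∀ y w, gV y w = ∑ k, w k • G' k y := fun y w => by
    simp only [hgV, Finset.sum_apply, sum_apply, hLapply]
  -- local integrability of `gV`
  have hgVloc : LocallyIntegrableOn gV (exterior : Set E3) volume := by
    rw [hgV]
    exact Finset.sum_induction (fun k => fun y => L k (G' k y))
      (fun g => LocallyIntegrableOn g (exterior : Set E3) volume)
      (fun a b ha hb => LocallyIntegrableOn.add (ε'' := E3 →L[ℝ] E3) ha hb)
      ((integrable_zero E3 (E3 →L[ℝ] E3) volume).locallyIntegrable.locallyIntegrableOn _)
      (fun k _ => (L k).locallyIntegrableOn_comp (hG'loc k))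
  refine ⟨gV, ⟨hVloc, hgVloc, fun φ w hφ => ?_⟩, fun K hK hKU => ?_⟩
  · -- the identity against test functions
    obtain ⟨hφs, hφc, hφU⟩ := hφ
    have hφU' : tsupport φ ⊆ (exterior : Set E3) := hφU
    have hout : ∀ x, x ∉ (exterior : Set E3) → x ∉ tsupport φ := fun x hx hx' => hx (hφU' hx')
    rw [setIntegral_eq_integral_of_forall_compl_eq_zero fun x hx => by
        rw [fderiv_of_notMem_tsupport ℝ (hout x hx), zero_apply, zero_smul],
      setIntegral_eq_integral_of_forall_compl_eq_zero fun x hx => by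
        rw [image_eq_zero_of_notMem_tsupport (hout x hx), zero_smul]]
    -- expand `∂_w φ = Σ_k w_k ∂_k φ`
    have hw : w = ∑ k, w k • EuclideanSpace.single k (1 : ℝ) := by
      simpa using ((EuclideanSpace.basisFun (Fin 3) ℝ).sum_repr w).symm
    have hDφ : ∀ x, fderiv ℝ φ x w = ∑ k, w k * fderiv ℝ φ x (EuclideanSpace.single k 1) := by
      intro x
      conv_lhs => rw [hw]
      simp only [map_sum, map_smul, smul_eq_mul]
    have hI1 : ∀ k, Integrable (fun x => (fderiv ℝ φ x (EuclideanSpace.single k 1)) • T.V x) :=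
      fun k => integrable_fderiv_smul_of_tsupport_subset isOpen_exterior hφs hφc hφU' hVloc _
    have hI2 : ∀ k, Integrable (fun x => φ x • G' k x) := fun k =>
      integrable_smul_of_tsupport_subset isOpen_exterior hφs.continuous hφc hφU' (hG'loc k)
    have hL1 : (fun x => (fderiv ℝ φ x w) • T.V x) =
        fun x => ∑ k, w k • ((fderiv ℝ φ x (EuclideanSpace.single k 1)) • T.V x) := by
      funext x; rw [hDφ x, Finset.sum_smul]; simp only [mul_smul]
    have hR1 : (fun x => φ x • gV x w) = fun x => ∑ k, w k • (φ x • G' k x) := by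
      funext x; rw [hgVapply, Finset.smul_sum]; simp only [smul_comm (φ x) (w _)]
    have eL := integral_finsetSum (μ := (volume : Measure E3)) Finset.univ
      (f := fun k x => w k • ((fderiv ℝ φ x (EuclideanSpace.single k 1)) • T.V x))
      fun k _ => (hI1 k).smul (w k)
    have eR := integral_finsetSum (μ := (volume : Measure E3)) Finset.univ
      (f := fun k x => w k • (φ x • G' k x)) fun k _ => (hI2 k).smul (w k)
    beta_reduce at eL eR
    rw [hL1, hR1, eL, eR, ← Finset.sum_neg_distrib]
    refine Finset.sum_congr rfl fun k _ => ?_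
    rw [integral_smul, integral_smul, hG'id k φ hφs hφc hφU', smul_neg]
  · -- `gV ∈ L^{9/5}(K)`
    have hgVm : AEStronglyMeasurable gV (volume.restrict K) :=
      (hgVloc.integrableOn_compact_subset hKU hK).1
    refine memLp_of_integrableOn_norm_rpow (by norm_num)
      (ENNReal.div_ne_top (by norm_num) (by norm_num)) hgVm ?_
    rw [ennreal_toReal_div_ofNat]
    have hb := ((hint K hK hKU).1).const_mul ((3 : ℝ) ^ ((9 : ℝ) / 5))
    refine hb.mono' ((hgVm.norm.aemeasurable.pow_const _).aestronglyMeasurable)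
      (Eventually.of_forall fun y => ?_)
    set sq : ℝ := ∑ k, ‖G y k‖ ^ 2 with hsq
    have hsq0 : 0 ≤ sq := Finset.sum_nonneg fun k _ => by positivity
    -- `‖gV y‖ ≤ 3 √sq`
    have hk : ∀ k, ‖G y k‖ ≤ Real.sqrt sq := fun k => by
      rw [← Real.sqrt_sq (norm_nonneg (G y k))]
      exact Real.sqrt_le_sqrt (Finset.single_le_sum (f := fun j => ‖G y j‖ ^ 2)
        (fun j _ => by positivity) (Finset.mem_univ k))
    have h1 : ‖gV y‖ ≤ 3 * Real.sqrt sq := by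
      calc ‖gV y‖ = ‖∑ k, L k (G' k y)‖ := by rw [hgV, Finset.sum_apply]
        _ ≤ ∑ k, ‖L k (G' k y)‖ := norm_sum_le _ _
        _ ≤ ∑ k, ‖G y k‖ := Finset.sum_le_sum fun k _ => (hLnorm k _).trans (hG'le k y)
        _ ≤ ∑ _k : Fin 3, Real.sqrt sq := Finset.sum_le_sum fun k _ => hk k
        _ = 3 * Real.sqrt sq := by simp
    rw [Real.norm_of_nonneg (by positivity)]
    calc ‖gV y‖ ^ ((9 : ℝ) / 5) ≤ (3 * Real.sqrt sq) ^ ((9 : ℝ) / 5) :=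
          Real.rpow_le_rpow (norm_nonneg _) h1 (by norm_num)
      _ = (3 : ℝ) ^ ((9 : ℝ) / 5) * sq ^ ((9 : ℝ) / 10) := by
          rw [Real.mul_rpow (by norm_num) (Real.sqrt_nonneg _), Real.sqrt_eq_rpow,
            ← Real.rpow_mul hsq0]
          norm_num

end Package

end Summit.NavierStokesRegularity.NavierStokesRegularity.Theorems.Wu2026Salvage
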